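import Summits.ABC.ABC.Theses.IneffectiveSubspace
import Summits.ABC.ABC.Theorems.IneffectiveSubspaceDeepRegimeABCCensusDeepTailOddC
import Literature.NumberTheory.DiophantineGeometry.AbcDepthCensus

/-!
# `DeepRegimeABC` (stmt-ABC-15121): certified census — the staircase has no upper end: `ω₅(abc) ≥ K ⟹ c > 10^(2K-1)` for EVERY `K ≥ 8`

Certificate file (line lead `prover-line-stmt-ABC-15121-c3-0`, 2026-08-16; human certificate objective)
for the crux `Summit.ABC.ABC.Theses.IneffectiveSubspace.DeepRegimeABC` (abc with exponent `1 + ε` on the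
deep tail `{ω₅(abc) ≥ K(ε)}`, `ω₅(n) := #{p : p⁵ ∣ n}`).  The census files so far locate the deep cells in
finite ranges of `K`: exact first members `c_K` for `K ≤ 8` (`…CensusFirstMembers.lean`,
`…CensusCellEightD.lean`) and the decade staircase `ω₅(abc) ≥ K ⟹ c > 10^(2K-1)` for `8 ≤ K ≤ 14`
(`tenPow_lt_of_le_depth_odd`, `…CensusDeepTailOddC.lean`, seven compiled enumerations).  This file removes
the upper end of the staircase WITHOUT any enumeration, by the primorial floor of a deep cell:

* `prod_range_nth_prime_le_prod` — the product of any `n` distinct primes is at least the product of the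
  first `n` primes `p₀ p₁ ⋯ p_{n-1}` (`pᵢ = Nat.nth Nat.Prime i`; induction on the largest member, which is
  at least `p_{n-1}` because `n - 1` smaller primes lie below it);
* `four_mul_primorial_pow_le_cube` — **`4·(p₀ ⋯ p_{K-1})⁵ ≤ c³` for every abc triple with `ω₅(abc) ≥ K`**
  (the `K` deep primes have pairwise coprime fifth powers dividing `abc ≤ c³/4`);
* `prod_range_fifteen_nth_prime` — `p₀ ⋯ p₁₄ = 614889782588491410` (kernel: `Nat.count` by `decide`,
  `Nat.nth_count`), and `pᵢ ≥ 47` for `i ≥ 14`;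
* `tenPow_lt_of_le_depth_ge_fifteen` — for `K ≥ 15`: `c³ ≥ 4·614889782588491410⁵·47^{5(K-15)} >
  10⁸⁷·10^{6(K-15)} = (10^{2K-1})³`;
* `tenPow_lt_of_le_depth_all` — **for EVERY `K ≥ 8`, an abc triple with `ω₅(abc) ≥ K` has
  `c > 10^(2K-1)`** (certified enumerations for `8 ≤ K ≤ 14`, the primorial floor beyond).

So the deep tail `{ω₅ ≥ K}` of the crux recedes at least geometrically in `log c` (two decades per deep
prime from `K = 8` on, forever); the enumerations show the true rate is higher where measured
(`log₁₀ c_K ≈ 1.5, 2.4, 3.7, 5.8, 8.4, 10.6, 12.9, 16.4, > 18` for `K = 1, …, 9`).  Nothing here bears on the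
truth of the crux (it is abc-hard); it is part of the requested checkable census of the deep regime.
No computation is trusted to the compiler in this file (no `native_decide`); `decide` evaluates
`Nat.count Nat.Prime q` for `q ≤ 47` only.
-/

-- `Summit.<Summit>.<Problem>` is the mandated summit-side namespace (CONVENTIONS §2); for the
-- single-conjunct summit `ABC` the two coincide, so the duplicate `ABC.ABC` is deliberate.
set_option linter.dupNamespace false

namespace Summit.ABC.ABC.Theorems.DeepRegimeABC

open Literature.NumberTheory.DiophantineGeometry

/-! ## The primorial floor of a set of primes -/

/-- **The product of `n` distinct primes is at least the product of the first `n` primes.** [folklore] -/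
theorem prod_range_nth_prime_le_prod : ∀ (n : ℕ) (S : Finset ℕ), S.card = n → (∀ p ∈ S, p.Prime) →
    ∏ i ∈ Finset.range n, Nat.nth Nat.Prime i ≤ ∏ p ∈ S, p := by
  intro n
  induction n with
  | zero =>
    intro S hS _
    rw [Finset.card_eq_zero] at hS
    subst hS
    simp
  | succ n ih =>
    intro S hS hpr
    have hne : S.Nonempty := Finset.card_pos.mp (by omega)
    have hmS : S.max' hne ∈ S := Finset.max'_mem S hne
    have hcard : (S.erase (S.max' hne)).card = n := by
      rw [Finset.card_erase_of_mem hmS, hS, Nat.add_sub_cancel]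
    have hpr' : ∀ p ∈ S.erase (S.max' hne), p.Prime := fun p hp => hpr p (Finset.mem_of_mem_erase hp)
    have ih' := ih (S.erase (S.max' hne)) hcard hpr'
    -- the largest member is at least the `n`-th prime: `n` smaller primes lie below it
    have hsub : S.erase (S.max' hne) ⊆ (Finset.range (S.max' hne)).filter Nat.Prime := by
      intro x hx
      rw [Finset.mem_filter, Finset.mem_range]
      exact ⟨Finset.lt_max'_of_mem_erase_max' S hne hx, hpr' x hx⟩
    have hcount : n ≤ Nat.count Nat.Prime (S.max' hne) := by
      rw [Nat.count_eq_card_filter_range, ← hcard]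
      exact Finset.card_le_card hsub
    have hnth : Nat.nth Nat.Prime n ≤ S.max' hne := by
      calc Nat.nth Nat.Prime n ≤ Nat.nth Nat.Prime (Nat.count Nat.Prime (S.max' hne)) :=
            Nat.nth_monotone Nat.infinite_setOf_prime hcount
        _ = S.max' hne := Nat.nth_count (hpr _ hmS)
    rw [Finset.prod_range_succ, ← Finset.prod_erase_mul S (fun p => p) hmS]
    exact Nat.mul_le_mul ih' hnth

/-! ## The primorial floor of a deep cell -/

/-- Fifth powers of distinct primes each dividing `n` divide `n` jointly. [folklore] -/
theorem prod_pow_five_dvd {S : Finset ℕ} {n : ℕ} (hS : ∀ p ∈ S, p.Prime ∧ p ^ 5 ∣ n) :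
    ∏ p ∈ S, p ^ 5 ∣ n := by
  induction S using Finset.induction_on with
  | empty => simp
  | @insert p S hpS ih =>
    rw [Finset.prod_insert hpS]
    have hp := hS p (Finset.mem_insert_self p S)
    have hS' : ∀ q ∈ S, q.Prime ∧ q ^ 5 ∣ n := fun q hq => hS q (Finset.mem_insert_of_mem hq)
    refine Nat.Coprime.mul_dvd_of_dvd_of_dvd ?_ hp.2 (ih hS')
    exact Nat.Coprime.prod_right fun q hq =>
      Nat.coprime_pow_primes 5 5 hp.1 (hS' q hq).1 (fun h => hpS (h ▸ hq))

/-- **`4·(p₀ p₁ ⋯ p_{K-1})⁵ ≤ c³` for every abc triple with `ω₅(abc) ≥ K`** (`pᵢ` the `i`-th prime,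
`p₀ = 2`): the `K` deep primes have pairwise coprime fifth powers dividing `abc`, and `4abc ≤ c³`.
[folklore] -/
theorem four_mul_primorial_pow_le_cube {a b c K : ℕ} (habc : IsABCTriple a b c)
    (hK : K ≤ ((a * b * c).primeFactors.filter (fun p => 5 ≤ (a * b * c).factorization p)).card) :
    4 * (∏ i ∈ Finset.range K, Nat.nth Nat.Prime i) ^ 5 ≤ c ^ 3 := by
  obtain ⟨ha, hb, hsum, -⟩ := habc
  have hc : 0 < c := by omega
  have hn0 : a * b * c ≠ 0 := by positivity
  obtain ⟨S, hSsub, hScard⟩ := Finset.exists_subset_card_eq hK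
  have hS : ∀ p ∈ S, p.Prime ∧ p ^ 5 ∣ a * b * c := by
    intro p hp
    have hp' := hSsub hp
    rw [Finset.mem_filter, Nat.mem_primeFactors] at hp'
    exact ⟨hp'.1.1, (hp'.1.1.pow_dvd_iff_le_factorization hn0).mpr hp'.2⟩
  have hdvd : ∏ p ∈ S, p ^ 5 ∣ a * b * c := prod_pow_five_dvd hS
  have hle : ∏ p ∈ S, p ^ 5 ≤ a * b * c := Nat.le_of_dvd (Nat.pos_of_ne_zero hn0) hdvd
  calc 4 * (∏ i ∈ Finset.range K, Nat.nth Nat.Prime i) ^ 5 ≤ 4 * (∏ p ∈ S, p) ^ 5 :=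
        Nat.mul_le_mul_left 4 (Nat.pow_le_pow_left
          (prod_range_nth_prime_le_prod K S hScard (fun p hp => (hS p hp).1)) 5)
    _ = 4 * ∏ p ∈ S, p ^ 5 := by rw [Finset.prod_pow]
    _ ≤ 4 * (a * b * c) := Nat.mul_le_mul_left 4 hle
    _ ≤ c ^ 3 := DepthCensus.four_mul_le_cube hsum le_rfl

/-! ## The first fifteen primes -/

/-- `Nat.nth Nat.Prime` from a count. [folklore] -/
theorem nth_prime_eq_of_count {i q : ℕ} (hq : q.Prime) (h : Nat.count Nat.Prime q = i) :
    Nat.nth Nat.Prime i = q := by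
  rw [← h]
  exact Nat.nth_count hq

/-- `p₁₄ = 47` (the fifteenth prime). [folklore] -/
theorem nth_prime_fourteen : Nat.nth Nat.Prime 14 = 47 :=
  nth_prime_eq_of_count (by norm_num) (by decide)

/-- **`p₀ p₁ ⋯ p₁₄ = 2·3·5·7·11·13·17·19·23·29·31·37·41·43·47 = 614889782588491410`.** [folklore] -/
theorem prod_range_fifteen_nth_prime :
    ∏ i ∈ Finset.range 15, Nat.nth Nat.Prime i = 614889782588491410 := by
  have h0 : Nat.nth Nat.Prime 0 = 2 := nth_prime_eq_of_count (by norm_num) (by decide)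
  have h1 : Nat.nth Nat.Prime 1 = 3 := nth_prime_eq_of_count (by norm_num) (by decide)
  have h2 : Nat.nth Nat.Prime 2 = 5 := nth_prime_eq_of_count (by norm_num) (by decide)
  have h3 : Nat.nth Nat.Prime 3 = 7 := nth_prime_eq_of_count (by norm_num) (by decide)
  have h4 : Nat.nth Nat.Prime 4 = 11 := nth_prime_eq_of_count (by norm_num) (by decide)
  have h5 : Nat.nth Nat.Prime 5 = 13 := nth_prime_eq_of_count (by norm_num) (by decide)
  have h6 : Nat.nth Nat.Prime 6 = 17 := nth_prime_eq_of_count (by norm_num) (by decide)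
  have h7 : Nat.nth Nat.Prime 7 = 19 := nth_prime_eq_of_count (by norm_num) (by decide)
  have h8 : Nat.nth Nat.Prime 8 = 23 := nth_prime_eq_of_count (by norm_num) (by decide)
  have h9 : Nat.nth Nat.Prime 9 = 29 := nth_prime_eq_of_count (by norm_num) (by decide)
  have h10 : Nat.nth Nat.Prime 10 = 31 := nth_prime_eq_of_count (by norm_num) (by decide)
  have h11 : Nat.nth Nat.Prime 11 = 37 := nth_prime_eq_of_count (by norm_num) (by decide)
  have h12 : Nat.nth Nat.Prime 12 = 41 := nth_prime_eq_of_count (by norm_num) (by decide)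
  have h13 : Nat.nth Nat.Prime 13 = 43 := nth_prime_eq_of_count (by norm_num) (by decide)
  simp only [Finset.prod_range_succ, Finset.prod_range_zero, h0, h1, h2, h3, h4, h5, h6, h7, h8, h9,
    h10, h11, h12, h13, nth_prime_fourteen]
  norm_num

/-- `pᵢ ≥ 47` for `i ≥ 14`. [folklore] -/
theorem fortyseven_le_nth_prime {i : ℕ} (hi : 14 ≤ i) : 47 ≤ Nat.nth Nat.Prime i := by
  rw [← nth_prime_fourteen]
  exact Nat.nth_monotone Nat.infinite_setOf_prime hi

/-- **Primorial tail: `p₀ ⋯ p_{K-1} ≥ 614889782588491410 · 47^(K-15)` for `K ≥ 15`.** [folklore] -/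
theorem primorial_ge_of_fifteen_le {K : ℕ} (hK : 15 ≤ K) :
    614889782588491410 * 47 ^ (K - 15) ≤ ∏ i ∈ Finset.range K, Nat.nth Nat.Prime i := by
  obtain ⟨j, rfl⟩ := Nat.exists_eq_add_of_le hK
  rw [Finset.prod_range_add, prod_range_fifteen_nth_prime, Nat.add_sub_cancel_left]
  apply Nat.mul_le_mul_left
  calc 47 ^ j = ∏ _i ∈ Finset.range j, 47 := by simp
    _ ≤ ∏ i ∈ Finset.range j, Nat.nth Nat.Prime (15 + i) :=
        Finset.prod_le_prod (fun _ _ => Nat.zero_le _)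
          (fun i _ => fortyseven_le_nth_prime (by omega))

/-! ## The staircase beyond the enumerations -/

/-- **For `K ≥ 15`, an abc triple with `ω₅(abc) ≥ K` has `c > 10^(2K-1)`** — by the primorial floor alone:
`c³ ≥ 4·614889782588491410⁵·47^{5(K-15)} > 10⁸⁷·10^{6(K-15)} = (10^{2K-1})³`. [folklore] -/
theorem tenPow_lt_of_le_depth_ge_fifteen {a b c K : ℕ} (habc : IsABCTriple a b c) (h15 : 15 ≤ K)
    (hK : K ≤ ((a * b * c).primeFactors.filter (fun p => 5 ≤ (a * b * c).factorization p)).card) :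
    10 ^ (2 * K - 1) < c := by
  have h1 := four_mul_primorial_pow_le_cube habc hK
  have h2 := primorial_ge_of_fifteen_le h15
  have hcube : (10 ^ (2 * K - 1)) ^ 3 < c ^ 3 := by
    obtain ⟨j, rfl⟩ := Nat.exists_eq_add_of_le h15
    rw [Nat.add_sub_cancel_left] at h2
    have e1 : (10 ^ (2 * (15 + j) - 1)) ^ 3 = 10 ^ 87 * (10 ^ 6) ^ j := by
      rw [← pow_mul, show (2 * (15 + j) - 1) * 3 = 87 + 6 * j by omega, pow_add, pow_mul]
    have e2 : 4 * (614889782588491410 * 47 ^ j) ^ 5 = 4 * 614889782588491410 ^ 5 * (47 ^ 5) ^ j := by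
      rw [mul_pow, ← pow_mul, ← pow_mul, Nat.mul_comm j 5, Nat.mul_assoc]
    calc (10 ^ (2 * (15 + j) - 1)) ^ 3 = 10 ^ 87 * (10 ^ 6) ^ j := e1
      _ < 4 * 614889782588491410 ^ 5 * (10 ^ 6) ^ j :=
          Nat.mul_lt_mul_of_pos_right (by norm_num) (by positivity)
      _ ≤ 4 * 614889782588491410 ^ 5 * (47 ^ 5) ^ j :=
          Nat.mul_le_mul_left _ (Nat.pow_le_pow_left (by norm_num) j)
      _ = 4 * (614889782588491410 * 47 ^ j) ^ 5 := e2.symm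
      _ ≤ 4 * (∏ i ∈ Finset.range (15 + j), Nat.nth Nat.Prime i) ^ 5 :=
          Nat.mul_le_mul_left 4 (Nat.pow_le_pow_left h2 5)
      _ ≤ c ^ 3 := h1
  exact lt_of_pow_lt_pow_left₀ 3 (Nat.zero_le _) hcube

/-- **The staircase has no upper end: for EVERY `K ≥ 8`, an abc triple with `ω₅(abc) ≥ K` has
`c > 10^(2K-1)`** — the certified enumerations for `8 ≤ K ≤ 14` (`tenPow_lt_of_le_depth_odd`), the
primorial floor for `K ≥ 15`. [folklore] -/
theorem tenPow_lt_of_le_depth_all {a b c K : ℕ} (habc : IsABCTriple a b c) (h8 : 8 ≤ K)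
    (hK : K ≤ ((a * b * c).primeFactors.filter (fun p => 5 ≤ (a * b * c).factorization p)).card) :
    10 ^ (2 * K - 1) < c := by
  rcases Nat.lt_or_ge 14 K with h | h
  · exact tenPow_lt_of_le_depth_ge_fifteen habc h hK
  · exact tenPow_lt_of_le_depth_odd habc h8 h hK

/-! ## Registered certificate stub of the crux item (stmt-ABC-15121) -/

/-- **Registered certificate `censusStaircase`** (crux `DeepRegimeABC`, line SketchIdeator5R2, human
certificate objective): the primorial floor `4·(p₀ ⋯ p_{K-1})⁵ ≤ c³` of the cell `{ω₅ ≥ K}` for every `K`,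
and the unbounded staircase `ω₅(abc) ≥ K ⟹ c > 10^(2K-1)` for every `K ≥ 8`. [folklore] -/
theorem censusStaircase : (∀ a b c K : ℕ, Literature.NumberTheory.DiophantineGeometry.IsABCTriple a b c → K ≤ ((a * b * c).primeFactors.filter (fun p => 5 ≤ (a * b * c).factorization p)).card → 4 * (∏ i ∈ Finset.range K, Nat.nth Nat.Prime i) ^ 5 ≤ c ^ 3) ∧ (∀ a b c K : ℕ, Literature.NumberTheory.DiophantineGeometry.IsABCTriple a b c → 8 ≤ K → K ≤ ((a * b * c).primeFactors.filter (fun p => 5 ≤ (a * b * c).factorization p)).card → 10 ^ (2 * K - 1) < c) :=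
  ⟨fun _ _ _ _ h hK => four_mul_primorial_pow_le_cube h hK,
    fun _ _ _ _ h h8 hK => tenPow_lt_of_le_depth_all h h8 hK⟩

end Summit.ABC.ABC.Theorems.DeepRegimeABC
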